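import Literature.NumberTheory.Automorphic.Liu2021.AppendixC.EtaleFaltingsTower
import HarnessLib

/-!
# [Liu 2021, Thm 4.18 proof l. 2245–2263] the Faltings isotypic identification `Ψ : ℂ ⊗_{M_μ} Ω(μ) ≃ Hom_{Γ_E}(ℚ_ℓ^{ac}·α, ℚ_ℓ^{ac} ⊗ H¹_ét(A_∞))`
# in the colimit over levels, II: `Ψ`, injective with range the `Γ_E`-compatible maps, `𝔾(𝔸_F^∞)`-equivariant — the generic form of the
# cell's `FaltingsIsotypic`

Topic `NumberTheory/Automorphic/Liu2021/AppendixC`; namespace `Literature.NumberTheory.Automorphic.Liu2021.AppendixC`.  Definitions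
with bodies + theorems; no named fact, no `sorry`; net Literature debt 0.  Continuation of `EtaleFaltingsTower.lean` / `EtaleFaltingsLevel.lean` (the level map `Φ_K`) over
the REAL carriers: `RestOne.ΩOne` / `HeckeTranslates.rhoΩOne` (the one-object `Ω(μ)` with its Hecke action, `RestOne.lean` / `RestOneHecke.lean`)
and `Sec42Data.etaleH1Tower` / `towerRep` / `EtaleHeckeDatum` / `EtaleHeckeDatum.IsInducedBy` (`EtaleH1Tower.lean`, `EtaleBettiComparison.lean`,
B-typ04).  Cell `hodgecm-mathlib` (D-0151), line `a3-liu418` v3 (1b96ade3f8b6b529), stub F `stub_faltingsIsotypic` (KEY `a3-faltings-isotypic`,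
seat A-p17): the final theorem `faltingsIsotypic_of_isInducedBy` has as conclusion the BODY of `Summit.….Lines.A3Liu418.FaltingsIsotypic T φ ι
hμ hw Car ℓ X ι'` (`Summits/…/HypLiu418/A3Liu418EtaleItems.lean`, p598646), so the skeleton's slot is filled BY NAME:
`theorem stub_faltingsIsotypic_of (hF) : StubFaltingsIsotypic := fun hDel F _ h6 ι₁ V a Φ hΦ ν hν hw ℓ _ X ι' hX =>
faltingsIsotypic_of_isInducedBy (CV hDel F V Φ) (AlgHom.id ℚ _) ι₁ hν hw (CarN F ι₁ ν hν) ℓ ι' (TV hDel F h6 V Φ) X hX (fun K obj => hF _ _ ℓ)`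
(slot test rc 0, axioms trio).  HC_CM is proved only modulo the 7 printed citations until rung 0 closes; this file is CONDITIONAL on the named
fact `Motives.faltings_tate_bijective` (VI-1) for the pairs `(A_K, A_μ)`, taken as the hypothesis `hF` — everything except the range clause
`⊇` is unconditional.

## The printed text (Y. Liu, arXiv:2102.11518, `FJcycle.tex` l. 2245–2263, print pp. 52–53)

«we have a canonical isomorphism `Ω(μ) ⊗_{M_μ,ι_ℓ} ℚ_ℓ^{ac} ≃ Hom_{ℚ_ℓ^{ac}[Gal(ℂ/τ'(E))]}(ℚ_ℓ^{ac}·α, H¹_ét(A_μ ⊗_{E,τ'} ℂ, ℚ_ℓ^{ac}))`»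
with `Ω(μ) = colim_K Hom_E(A_K, A_μ)_ℚ` (Rem. 4.17), `H¹_ét(A_∞) = colim_K H¹_ét(A_K)` (§4.3 l. 2158), and the `𝔾(𝔸_F^∞)`-actions on
both sides through the Hecke correspondences / translates (l. 2074, Def. 4.16 l. 2219).

## Contents of I (`EtaleFaltingsTower.lean`) and II (this file) (all PROVED; axioms `propext`, `Classical.choice`, `Quot.sound`)

* Tower side: `toTower_baseChange_comp_h1PullBar` (`[·]_{K'} ∘ Alb_u^* = [·]_K`), `exists_eq_toTower_baseChange` (every class of
  `ℚ_ℓ^{ac} ⊗ H¹_ét(A_∞)` lives at a small level), `towerRep_baseChange_comp_toTower` (Galois), `rhoEt_baseChange_comp_toTower`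
  (Hecke, from `IsInducedBy`), `toTower_baseChange_injective` (flatness of `ℚ_ℓ^{ac}/ℚ_ℓ`).
* `Ω` side: `resOneₗ` (`res_K` at the chosen object, `M_μ`-linear), `exists_eq_resOne`, `exists_eq_lTensor_resOneₗ` (every element of
  `ℂ ⊗_{M_μ} Ω(μ)` comes from ONE level below any threshold — directedness, `RestOne.isDirectedOrder_idx`).
* `towerHomModule` (the `M_μ`-structure on the target through `ι|_{M_μ}`, used with `letI` only), `faltingsTowerLevel` (+ `_apply`, `_sys`),
  `faltingsTower` = the map out of `colim_K` (`Module.DirectLimit.lift`; `faltingsTower_resOf`, `faltingsTower_smul`),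
  `faltingsPsiAddHom`, **`faltingsPsi = Ψ`** (`ι`-semilinear; `faltingsPsi_tmul`, **`faltingsPsi_lTensor_resOneₗ`**: `Ψ ∘ (1 ⊗ res_K) = [·]_K ∘ Φ_K`).
* **`faltingsPsi_injective`** (unconditional; uses an étale Hecke datum only through `levelCompat`), **`towerRep_faltingsPsi_apply`** (range ⊆),
  **`exists_faltingsPsi_eq`** (range ⊇, granted Faltings), **`faltingsPsi_rhoΩOne`** (`𝔾`-equivariance for `X` induced by `T`:
  `heckeRep_resOf` + `IsInducedBy`), and the assembly **`faltingsIsotypic_of_isInducedBy`** (conjunct (i) = `finrank_cmEigenline_eq_one`).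

References: [Liu2021] Thm 4.18 proof l. 2245–2263, §4.2 l. 2070–2074, §4.3 l. 2158–2160, Def. 4.16, Rem. 4.17; [Faltings1983Endlichkeit] §5
Satz 4, Korollar 1; [SerreTate1968] §4 Thm. 5 (i); [MumfordAV1970] §19 Thm. 3.
-/

noncomputable section

open CategoryTheory NumberField
open scoped TensorProduct

namespace Literature.NumberTheory.Automorphic.Liu2021.AppendixC

open Literature.AlgebraicGeometry.Motives (AbelianVariety faltings_tate_bijective faltings_rationalTate_bijective_of)
open Literature.AlgebraicGeometry.Motives.AbelianVariety (rationalTateModuleMap rationalTateModuleMap_comp rationalTateModuleMap_add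
  rationalTateModuleMap_zero rationalTateModuleMap_id rationalTateRep_rationalTateModuleMap rationalTateAction rationalTateAction_of
  rationalTateAction_algebraMap module_finite_tateModule_of_cast_ne_zero endAlgebra faltingsRationalTateMap rationalTateHom
  toLinearMap_rationalTateIntertwiningMap faltingsRationalTateMap_tmul)
open Literature.RepresentationTheory.IntertwiningBaseChange Literature.RepresentationTheory.IntertwiningDual

/-! ## §5 `Ψ` and its three properties; the assembly -/

section Colimit

variable {F₀ E : Type} [Field F₀] [NumberField F₀] [IsTotallyReal F₀] [Field E] [NumberField E] [Algebra F₀ E]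
  [IsTotallyComplex E] [Algebra.IsQuadraticExtension F₀ E] [IsCMField E]
variable {P5 : PropC5Data F₀ E} {isotropicAt : ℕ → Prop} (C : Sec42Data P5 isotropicAt)
variable {L : Type} [Field L] [NumberField L] [IsGalois ℚ L] (φ : E →ₐ[ℚ] L) (ιE : L →+* ℂ)
variable {μ : IdeleClassGroup E →ₜ* Circle} (hμ : IdeleClassGroup.IsConjugateSymplectic E μ)
  (hw : IdeleClassGroup.HasWeight E μ 1) (Car : Def45.Carriers E μ)
variable (obj : RestOne.ObjOne φ ιE hμ hw Car) (ℓ : ℕ) [Fact ℓ.Prime] (ι : ℂ ≃+* AlgebraicClosure ℚ_[ℓ])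

open RestOne (QHom AμOne iOne ObjOne ofFieldOfValues ΩOne ΩOf resOf resOne Idx sysObj sys pre preₛ)
open scoped Literature.NumberTheory.Automorphic.Liu2021.AppendixC.RestOne
open scoped Classical

set_option maxHeartbeats 1600000 in
-- (the one-object carriers `ΩOne = Π_{ObjOne} colim_K ℚ ⊗ Hom` make instance unification slow; no search-depth change)
/-- **`Ψ` as an additive map**: `z ⊗ w ↦ ι(z) · faltingsTower (w D_μ)` on `ℂ ⊗_{M_μ} Ω(μ)` (`Ω(μ)` at the one object is the product over the
subsingleton `ObjOne`; the chosen object `obj` picks the factor).  Well defined by `faltingsTower_smul`. [cite: Liu2021, Thm 4.18 proof (FJcycle.tex l. 2254–2262)] -/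
def faltingsPsiAddHom : ℂ ⊗[fieldOfValues E μ] ΩOne C φ ιE hμ hw Car →+
    (cmEigenline ℓ (AμOne φ ιE hμ hw Car obj) (IdeleClassGroup.muAlgValueField E μ) (iOne φ ιE hμ hw Car obj) ι →ₗ[AlgebraicClosure ℚ_[ℓ]]
      AlgebraicClosure ℚ_[ℓ] ⊗[ℚ_[ℓ]] C.etaleH1Tower ℓ) :=
  TensorProduct.liftAddHom
    (AddMonoidHom.mk' (fun z => AddMonoidHom.mk' (fun w => ι z • faltingsTower C φ ιE hμ hw Car obj ℓ ι (w obj))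
        (fun w w' => by rw [Pi.add_apply, (faltingsTower C φ ιE hμ hw Car obj ℓ ι).map_add, smul_add]))
      (fun z z' => AddMonoidHom.ext fun w => by
        change ι (z + z') • faltingsTower C φ ιE hμ hw Car obj ℓ ι (w obj) =
          ι z • faltingsTower C φ ιE hμ hw Car obj ℓ ι (w obj) + ι z' • faltingsTower C φ ιE hμ hw Car obj ℓ ι (w obj)
        rw [ι.map_add, add_smul]))
    (fun s z w => by
      change ι (s • z) • faltingsTower C φ ιE hμ hw Car obj ℓ ι (w obj) = ι z • faltingsTower C φ ιE hμ hw Car obj ℓ ι ((s • w) obj)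
      rw [Pi.smul_apply, faltingsTower_smul, smul_smul, Algebra.smul_def, ι.map_mul, mul_comm]
      rfl)

/-- `Ψ` on pure tensors. [cite: Liu2021, Thm 4.18 proof (FJcycle.tex l. 2254–2262)] -/
theorem faltingsPsiAddHom_tmul (z : ℂ) (w : ΩOne C φ ιE hμ hw Car) :
    faltingsPsiAddHom C φ ιE hμ hw Car obj ℓ ι (z ⊗ₜ w) = ι z • faltingsTower C φ ιE hμ hw Car obj ℓ ι (w obj) := by
  rw [faltingsPsiAddHom, TensorProduct.liftAddHom_tmul]
  rfl

set_option maxHeartbeats 1600000 in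
-- (the one-object carriers `ΩOne = Π_{ObjOne} colim_K ℚ ⊗ Hom` make instance unification slow; no search-depth change)
set_option maxHeartbeats 1600000 in
-- (the one-object carriers `ΩOne = Π_{ObjOne} colim_K ℚ ⊗ Hom` make instance unification slow; no search-depth change)
/-- **`Ψ : ℂ ⊗_{M_μ} Ω(μ) → Hom(ℚ_ℓ^{ac}·α, ℚ_ℓ^{ac} ⊗ H¹_ét(A_∞))`, `ι`-SEMILINEAR** — the map «`Ω(μ) ⊗_{M_μ,ι_ℓ} ℚ_ℓ^{ac} → Hom(ℚ_ℓ^{ac}·α,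
H¹_ét(A_∞ …))`» of [Liu2021] l. 2254–2262 («induced by pulling back `α`»), over the REAL one-object `Ω(μ)` of `RestOne.lean` and the REAL
`ℓ`-adic tower of `EtaleH1Tower.lean`. [cite: Liu2021, Thm 4.18 proof (FJcycle.tex l. 2254–2262)] -/
def faltingsPsi : ℂ ⊗[fieldOfValues E μ] ΩOne C φ ιE hμ hw Car →ₛₗ[(ι : ℂ →+* AlgebraicClosure ℚ_[ℓ])]
    (cmEigenline ℓ (AμOne φ ιE hμ hw Car obj) (IdeleClassGroup.muAlgValueField E μ) (iOne φ ιE hμ hw Car obj) ι →ₗ[AlgebraicClosure ℚ_[ℓ]]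
      AlgebraicClosure ℚ_[ℓ] ⊗[ℚ_[ℓ]] C.etaleH1Tower ℓ) :=
  { faltingsPsiAddHom C φ ιE hμ hw Car obj ℓ ι with
    map_smul' := fun z w => by
      change faltingsPsiAddHom C φ ιE hμ hw Car obj ℓ ι (z • w) = ι z • faltingsPsiAddHom C φ ιE hμ hw Car obj ℓ ι w
      induction w using TensorProduct.induction_on with
      | zero => rw [smul_zero, map_zero, smul_zero]
      | tmul z' x => rw [TensorProduct.smul_tmul', smul_eq_mul, faltingsPsiAddHom_tmul, faltingsPsiAddHom_tmul, map_mul, mul_smul]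
      | add x y hx hy => rw [smul_add, map_add, map_add, hx, hy, smul_add] }

/-- `Ψ` on pure tensors. [cite: Liu2021, Thm 4.18 proof (FJcycle.tex l. 2254–2262)] -/
theorem faltingsPsi_tmul (z : ℂ) (w : ΩOne C φ ιE hμ hw Car) :
    faltingsPsi C φ ιE hμ hw Car obj ℓ ι (z ⊗ₜ w) = ι z • faltingsTower C φ ιE hμ hw Car obj ℓ ι (w obj) :=
  faltingsPsiAddHom_tmul C φ ιE hμ hw Car obj ℓ ι z w

set_option maxHeartbeats 400000 in
/-- **`Ψ` IS the level map `Φ_K` followed by `[·]_K`** on classes coming from level `K`: `Ψ ∘ (1 ⊗ res_K) = [·]_K ∘ Φ_K`.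
[cite: Liu2021, Thm 4.18 proof (FJcycle.tex l. 2254–2262); Rem. 4.17] -/
theorem faltingsPsi_lTensor_resOneₗ (K : C5.SmallLevel C.S.K₀) (u : ℂ ⊗[fieldOfValues E μ] C.HomQ K (AμOne φ ιE hμ hw Car obj)) :
    faltingsPsi C φ ιE hμ hw Car obj ℓ ι ((resOneₗ C φ ιE hμ hw Car obj K).lTensor ℂ u) =
      (C.toTower ℓ K).baseChange (AlgebraicClosure ℚ_[ℓ]) ∘ₗ faltingsLevel φ ιE hμ hw Car obj ℓ ι (C.A K) u := by
  induction u using TensorProduct.induction_on with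
  | zero => rw [map_zero, map_zero, map_zero, LinearMap.comp_zero]
  | tmul z t =>
    rw [LinearMap.lTensor_tmul, faltingsPsi_tmul, resOneₗ_apply]
    change ι z • faltingsTower C φ ιE hμ hw Car obj ℓ ι (resOf C (AμOne φ ιE hμ hw Car obj) (fieldOfValues E μ) K t) = _
    rw [faltingsTower_resOf]
    refine LinearMap.ext fun y => ?_
    rw [LinearMap.smul_apply, LinearMap.comp_apply, LinearMap.comp_apply, faltingsLevel_tmul_apply, faltingsLevel_tmul_apply, map_one, one_smul,
      map_smul]
  | add x y hx hy => rw [map_add, map_add, map_add, hx, hy, LinearMap.comp_add]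

/-- **INJECTIVITY of `Ψ`** (first clause of l. 2258's «canonical isomorphism», in the colimit): given ANY étale Hecke datum `X` (only its level
compatibility is used — classes from a small level `K` embed into `H¹_ét(A_∞)`), `Ψ` is injective: a class of `ℂ ⊗_{M_μ} Ω(μ)` lives at one
level `K` (`exists_eq_lTensor_resOneₗ`), where `Ψ = [·]_K ∘ Φ_K` with both factors injective (`faltingsLevel_injective`, flatness).
UNCONDITIONAL (no Faltings). [cite: Liu2021, Thm 4.18 proof (FJcycle.tex l. 2254–2262)] [cite: MumfordAV1970, §19 Thm. 3] -/
theorem faltingsPsi_injective (X : C.EtaleHeckeDatum ℓ) : Function.Injective (faltingsPsi C φ ιE hμ hw Car obj ℓ ι) := by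
  obtain ⟨K₁, hK₁⟩ := X.levelCompat
  refine (injective_iff_map_eq_zero _).mpr fun w hw0 => ?_
  obtain ⟨K, hK, u, rfl⟩ := exists_eq_lTensor_resOneₗ C φ ιE hμ hw Car obj K₁ w
  rw [faltingsPsi_lTensor_resOneₗ] at hw0
  have hinj := toTower_baseChange_injective C ℓ (hK₁ K hK).1
  have hu : faltingsLevel φ ιE hμ hw Car obj ℓ ι (C.A K) u = 0 := by
    refine LinearMap.ext fun y => hinj ?_
    rw [← LinearMap.comp_apply, hw0, LinearMap.zero_apply, LinearMap.zero_apply, map_zero]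
  rw [(injective_iff_map_eq_zero _).mp (faltingsLevel_injective φ ιE hμ hw Car obj ℓ ι (C.A K)) u hu, map_zero]

/-- **Range ⊆**: every value `Ψ(w)` is `Γ_E`-compatible — `σ` acts on `Ψ(w)(y)` by the scalar by which it acts on the line.
[cite: Liu2021, Thm 4.18 proof (FJcycle.tex l. 2258–2263)] -/
theorem towerRep_faltingsPsi_apply (w : ℂ ⊗[fieldOfValues E μ] ΩOne C φ ιE hμ hw Car) (σ : Field.absoluteGaloisGroup E) (c : AlgebraicClosure ℚ_[ℓ])
    (hc : ∀ x ∈ cmEigenline ℓ (AμOne φ ιE hμ hw Car obj) (IdeleClassGroup.muAlgValueField E μ) (iOne φ ιE hμ hw Car obj) ι,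
      galoisH1Bar ℓ (AμOne φ ιE hμ hw Car obj) σ x = c • x)
    (y : cmEigenline ℓ (AμOne φ ιE hμ hw Car obj) (IdeleClassGroup.muAlgValueField E μ) (iOne φ ιE hμ hw Car obj) ι) :
    (C.towerRep ℓ σ).baseChange (AlgebraicClosure ℚ_[ℓ]) (faltingsPsi C φ ιE hμ hw Car obj ℓ ι w y) = c • faltingsPsi C φ ιE hμ hw Car obj ℓ ι w y := by
  obtain ⟨K, -, u, rfl⟩ := exists_eq_lTensor_resOneₗ C φ ιE hμ hw Car obj ⟨C.S.K₀, le_rfl⟩ w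
  rw [faltingsPsi_lTensor_resOneₗ, LinearMap.comp_apply, ← LinearMap.comp_apply _ ((C.toTower ℓ K).baseChange (AlgebraicClosure ℚ_[ℓ])),
    towerRep_baseChange_comp_toTower, LinearMap.comp_apply, galoisH1Bar_faltingsLevel_apply φ ιE hμ hw Car obj ℓ ι (C.A K) u σ c hc, map_smul]

/-- **Range ⊇** (second clause of l. 2258–2262, in the colimit), GRANTED Faltings at every level `K` (hypothesis `hF`, the named fact
`faltings_tate_bijective (A_K) (A_μ) ℓ` = VI-1) and given an étale Hecke datum `X` (level compatibility): every `Γ_E`-compatible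
`h : ℚ_ℓ^{ac}·α → ℚ_ℓ^{ac} ⊗ H¹_ét(A_∞)` is `Ψ(w)`.  Proof: `h(α)` lives at a small level `K` (directedness), where `[·]_K` is injective; the
lift of `h` to level `K` is `Γ_E`-compatible, hence `Φ_K(u)` by `exists_faltingsLevel_eq`. [cite: Liu2021, Thm 4.18 proof (FJcycle.tex l. 2254–2262)]
[cite: Faltings1983Endlichkeit, §5 Satz 4 and Korollar 1] -/
theorem exists_faltingsPsi_eq (X : C.EtaleHeckeDatum ℓ) (hF : ∀ K : C5.SmallLevel C.S.K₀, faltings_tate_bijective (C.A K) (AμOne φ ιE hμ hw Car obj) ℓ)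
    (h : cmEigenline ℓ (AμOne φ ιE hμ hw Car obj) (IdeleClassGroup.muAlgValueField E μ) (iOne φ ιE hμ hw Car obj) ι →ₗ[AlgebraicClosure ℚ_[ℓ]]
      AlgebraicClosure ℚ_[ℓ] ⊗[ℚ_[ℓ]] C.etaleH1Tower ℓ)
    (hh : ∀ (σ : Field.absoluteGaloisGroup E) (c : AlgebraicClosure ℚ_[ℓ]),
      (∀ x ∈ cmEigenline ℓ (AμOne φ ιE hμ hw Car obj) (IdeleClassGroup.muAlgValueField E μ) (iOne φ ιE hμ hw Car obj) ι,
        galoisH1Bar ℓ (AμOne φ ιE hμ hw Car obj) σ x = c • x) →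
      ∀ y, (C.towerRep ℓ σ).baseChange (AlgebraicClosure ℚ_[ℓ]) (h y) = c • h y) :
    ∃ w, faltingsPsi C φ ιE hμ hw Car obj ℓ ι w = h := by
  haveI : FiniteDimensional ℚ (IdeleClassGroup.muAlgValueField E μ) := hμ.finiteDimensional_muAlgValueField
  haveI : NumberField (IdeleClassGroup.muAlgValueField E μ) := NumberField.mk
  haveI := finite_rationalTateModule ℓ (AμOne φ ιE hμ hw Car obj)
  obtain ⟨K₁, hK₁⟩ := X.levelCompat
  have h1 := finrank_cmEigenline_eq_one ℓ (AμOne φ ιE hμ hw Car obj) (IdeleClassGroup.muAlgValueField E μ) (iOne φ ιE hμ hw Car obj) ι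
    (Literature.AlgebraicGeometry.Motives.natCast_ne_zero_of_numberField ℓ) (RestOne.hdimOne φ ιE hμ hw Car obj)
  let b := Module.finBasisOfFinrankEq _ _ h1
  obtain ⟨K, hK, x, hx⟩ := exists_eq_toTower_baseChange C ℓ K₁ (h (b 0))
  have hinj := toTower_baseChange_injective C ℓ (hK₁ K hK).1
  let hK' := b.constr (AlgebraicClosure ℚ_[ℓ]) fun _ => x
  have hcomp : (C.toTower ℓ K).baseChange (AlgebraicClosure ℚ_[ℓ]) ∘ₗ hK' = h := by
    refine b.ext fun j => ?_
    obtain rfl : j = 0 := Subsingleton.elim _ _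
    rw [LinearMap.comp_apply, Module.Basis.constr_basis, hx]
  have hhK : ∀ (σ : Field.absoluteGaloisGroup E) (c : AlgebraicClosure ℚ_[ℓ]),
      (∀ x ∈ cmEigenline ℓ (AμOne φ ιE hμ hw Car obj) (IdeleClassGroup.muAlgValueField E μ) (iOne φ ιE hμ hw Car obj) ι,
        galoisH1Bar ℓ (AμOne φ ιE hμ hw Car obj) σ x = c • x) →
      ∀ y, galoisH1Bar ℓ (C.A K) σ (hK' y) = c • hK' y := by
    intro σ c hc y
    apply hinj
    rw [map_smul, ← LinearMap.comp_apply, ← towerRep_baseChange_comp_toTower, LinearMap.comp_apply, ← LinearMap.comp_apply _ hK', hcomp,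
      hh σ c hc y]
  obtain ⟨u, hu⟩ := exists_faltingsLevel_eq φ ιE hμ hw Car obj ℓ ι (C.A K) (hF K) hK' hhK
  exact ⟨(resOneₗ C φ ιE hμ hw Car obj K).lTensor ℂ u, by rw [faltingsPsi_lTensor_resOneₗ, hu, hcomp]⟩

set_option maxHeartbeats 1600000 in
-- (the one-object carriers `ΩOne = Π_{ObjOne} colim_K ℚ ⊗ Hom` make instance unification slow; no search-depth change)
variable {C ℓ} in
/-- **`𝔾(𝔸_F^∞)`-EQUIVARIANCE of `Ψ`** for an étale Hecke datum INDUCED by the translates `T` (`IsInducedBy`): `Ψ((g ⊗ 1) w) = (g ⊗ 1) ∘ Ψ(w)`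
— both Hecke actions are pull-back along `Alb(T_g)` (`heckeRep_resOf` on `Ω(μ)`, `IsInducedBy` on `H¹_ét(A_∞)`).
[cite: Liu2021, §4.2 l. 2074, Def. 4.16 l. 2219, Thm 4.18 proof l. 2254–2262] -/
theorem faltingsPsi_rhoΩOne {X : C.EtaleHeckeDatum ℓ} {T : C.HeckeTranslates} (hX : X.IsInducedBy T) (g : C.G)
    (w : ℂ ⊗[fieldOfValues E μ] ΩOne C φ ιE hμ hw Car)
    (y : cmEigenline ℓ (AμOne φ ιE hμ hw Car obj) (IdeleClassGroup.muAlgValueField E μ) (iOne φ ιE hμ hw Car obj) ι) :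
    faltingsPsi C φ ιE hμ hw Car obj ℓ ι ((T.rhoΩOne φ ιE hμ hw Car g).baseChange ℂ w) y =
      (X.rhoEt g).baseChange (AlgebraicClosure ℚ_[ℓ]) (faltingsPsi C φ ιE hμ hw Car obj ℓ ι w y) := by
  induction w using TensorProduct.induction_on with
  | zero => rw [map_zero, map_zero, LinearMap.zero_apply, map_zero]
  | tmul z x =>
    obtain ⟨K, -, t, rfl⟩ := exists_eq_resOne C φ ιE hμ hw Car obj ⟨C.S.K₀, le_rfl⟩ x
    rw [LinearMap.baseChange_tmul, T.rhoΩOne_resOne φ ιE hμ hw Car g (C5.heckeLE_heckeLevel g K) obj t, faltingsPsi_tmul, faltingsPsi_tmul]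
    change ι z • faltingsTower C φ ιE hμ hw Car obj ℓ ι (resOf C _ _ (C5.heckeLevel g K) (pre _ (T.albTr g (C5.heckeLevel g K) K _) t)) y =
      (X.rhoEt g).baseChange (AlgebraicClosure ℚ_[ℓ]) (ι z • faltingsTower C φ ιE hμ hw Car obj ℓ ι (resOf C _ _ K t) y)
    rw [faltingsTower_resOf, faltingsTower_resOf, map_smul, LinearMap.comp_apply, LinearMap.comp_apply, faltingsLevel_tmul_pre_apply]
    have key := LinearMap.congr_fun (rhoEt_baseChange_comp_toTower hX g (C5.heckeLevel g K) K (C5.heckeLE_heckeLevel g K))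
      (faltingsLevel φ ιE hμ hw Car obj ℓ ι (C.A K) ((1 : ℂ) ⊗ₜ t) y)
    rw [LinearMap.comp_apply, LinearMap.comp_apply] at key
    rw [key]
  | add x x' hx hx' => simp only [map_add, LinearMap.add_apply, hx, hx']

/-- **[Liu 2021, Thm 4.18 proof l. 2245–2263] — the FALTINGS ISOTYPIC IDENTIFICATION at the one object, GENERIC** (the body of the cell's
`FaltingsIsotypic T φ ι hμ hw Car ℓ X ι'`, `Lines/a3-liu418.lean` v3 §EtaleItems = `Summits/…/A3Liu418EtaleItems.lean`): for a §4.2 datum `C`,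
its Hecke translates `T`, an étale Hecke datum `X` INDUCED by `T`, `ι : ℂ ≃ ℚ_ℓ^{ac}`, and the [Def 4.5] character datum `(μ, hμ, hw, Car)`
read at `(φ, ιE)`: GRANTED Faltings' theorem for the pairs `(A_K, A_μ)` (hypothesis `hF` — the named fact VI-1
`Motives.faltings_tate_bijective`, NOT discharged here), for every object `D_μ` — (i) the line `ℚ_ℓ^{ac}·α` is a line; (ii) `Ψ` is an
`ι`-semilinear INJECTION `ℂ ⊗_{M_μ} Ω(μ) → Hom(ℚ_ℓ^{ac}·α, ℚ_ℓ^{ac} ⊗ H¹_ét(A_∞))` with range EXACTLY the `Γ_E`-compatible maps, intertwining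
`rhoΩ ⊗ 1` with `rhoEt`.  Everything except the range clause `⊇` is unconditional. HC_CM is proved only modulo the 7 printed citations.
[cite: Liu2021, Thm 4.18 proof (FJcycle.tex l. 2245–2263)] [cite: Faltings1983Endlichkeit, §5 Satz 4 and Korollar 1] [cite: SerreTate1968, §4 Thm. 5 (i)] -/
theorem faltingsIsotypic_of_isInducedBy (T : C.HeckeTranslates) (X : C.EtaleHeckeDatum ℓ) (hX : X.IsInducedBy T)
    (hF : ∀ (K : C5.SmallLevel C.S.K₀) (obj : ObjOne φ ιE hμ hw Car), faltings_tate_bijective (C.A K) (AμOne φ ιE hμ hw Car obj) ℓ) :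
    ∀ obj : RestOne.ObjOne φ ιE hμ hw Car,
      Module.finrank (AlgebraicClosure ℚ_[ℓ])
          (cmEigenline ℓ (RestOne.AμOne φ ιE hμ hw Car obj) (IdeleClassGroup.muAlgValueField E μ) (RestOne.iOne φ ιE hμ hw Car obj) ι) = 1 ∧
      ∃ Ψ : (ℂ ⊗[fieldOfValues E μ] RestOne.ΩOne C φ ιE hμ hw Car) →ₛₗ[(ι : ℂ →+* AlgebraicClosure ℚ_[ℓ])]
          (cmEigenline ℓ (RestOne.AμOne φ ιE hμ hw Car obj) (IdeleClassGroup.muAlgValueField E μ) (RestOne.iOne φ ιE hμ hw Car obj) ι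
            →ₗ[AlgebraicClosure ℚ_[ℓ]] AlgebraicClosure ℚ_[ℓ] ⊗[ℚ_[ℓ]] C.etaleH1Tower ℓ),
        Function.Injective Ψ ∧
        Set.range Ψ =
          {h | ∀ (σ : Field.absoluteGaloisGroup E) (c : AlgebraicClosure ℚ_[ℓ]),
            (∀ x ∈ cmEigenline ℓ (RestOne.AμOne φ ιE hμ hw Car obj) (IdeleClassGroup.muAlgValueField E μ) (RestOne.iOne φ ιE hμ hw Car obj) ι,
                galoisH1Bar ℓ (RestOne.AμOne φ ιE hμ hw Car obj) σ x = c • x) →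
              ∀ y, (C.towerRep ℓ σ).baseChange (AlgebraicClosure ℚ_[ℓ]) (h y) = c • h y} ∧
        ∀ (g : C.G) (w : ℂ ⊗[fieldOfValues E μ] RestOne.ΩOne C φ ιE hμ hw Car) (y),
          Ψ ((T.rhoΩOne φ ιE hμ hw Car g).baseChange ℂ w) y = (X.rhoEt g).baseChange (AlgebraicClosure ℚ_[ℓ]) (Ψ w y) := by
  intro obj
  haveI : FiniteDimensional ℚ (IdeleClassGroup.muAlgValueField E μ) := hμ.finiteDimensional_muAlgValueField
  haveI : NumberField (IdeleClassGroup.muAlgValueField E μ) := NumberField.mk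
  refine ⟨finrank_cmEigenline_eq_one ℓ _ _ _ ι (Literature.AlgebraicGeometry.Motives.natCast_ne_zero_of_numberField ℓ)
    (RestOne.hdimOne φ ιE hμ hw Car obj), faltingsPsi C φ ιE hμ hw Car obj ℓ ι, faltingsPsi_injective C φ ιE hμ hw Car obj ℓ ι X, ?_,
    fun g w y => faltingsPsi_rhoΩOne φ ιE hμ hw Car obj ι hX g w y⟩
  ext h
  constructor
  · rintro ⟨w, rfl⟩ σ c hc y
    exact towerRep_faltingsPsi_apply C φ ιE hμ hw Car obj ℓ ι w σ c hc y
  · intro hh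
    exact exists_faltingsPsi_eq C φ ιE hμ hw Car obj ℓ ι X (fun K => hF K obj) h hh

end Colimit

end Literature.NumberTheory.Automorphic.Liu2021.AppendixC

end
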